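import Summits.KontsevichZagierPeriods.KontsevichZagierPeriods.Theorems.SymplecticScissorsVolumeFormOffPlaneBinomialSector
import Summits.KontsevichZagierPeriods.KontsevichZagierPeriods.Theorems.SymplecticScissorsVolumeFormOffPlaneBinomialCellToBox
import Summits.KontsevichZagierPeriods.KontsevichZagierPeriods.Theorems.SymplecticScissorsVolumeFormOffPlaneMatrixPowerMove

/-!
# Crux `VolumeFormOffPlane` (stmt-KontsevichZagierPeriods-14935) — line `Sketch`,
stub `stub_binomialCertificate` (every binomial cell carries a torsion certificate over Λ-boxes)

Box-dimension `n + 1` (total `n + 2`), box coordinates `x_j = p (Fin.castSucc j)`, slack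
`z = p (Fin.last (n + 1))`. For `α, β > 0` real algebraic, `M ∈ ℤ^{(n+1)×(n+1)}` with
`det M ≠ 0`, a positive real-algebraic corner `sa` and the Λ-datum `sc = (∏ sa) · α^{su} β^{sv}`
with `α^{su} β^{sv} > 1`, every integrand-`1` representation `ρ` on the BINOMIAL CELL
`{x > 0, sa_k < ∏_j x_j^{M k j}, ∏_k ∏_j x_j^{M k j} < sc, slack}` carries a torsion certificate
with `d = 1` and one Λ-box: `[ρ] − [σ] ∈ KZ.relations` for an integrand-`1` representation `σ` on
the corner-`1` log-box with edge ratios `α^{U ι} β^{V ι}`, `U = (su, …, su)[0 ↦ su / N]`,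
`V = (sv, …, sv)[0 ↦ sv / N]`, `N = |det M| · (n + 1)!`.

Proof (bookkeeping over landed siblings): the box representation exists (`stub_logBoxCut.1`);
its domain, rewritten through `bsc_box_eq`, is literally the corner-`1` box with upper corners
`(g, …, g)[0 ↦ g^{1/N}]`, `g = sc / ∏ sa = α^{su} β^{sv}`, so `stub_binomialCellToBox` fed with
`stub_matrixPowerMove` gives `[ρ] − [σ] ∈ KZ.relations`; the ratios exceed `1` (`mxs_root_eq`,
`Real.one_lt_rpow`) and are real algebraic (`mxs_rpow_isAlgebraic`).

Sources: M. Kontsevich, D. Zagier, *Periods* (2001), §1.2 (the moves and their soundness); the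
bookkeeping is folklore.
-/

noncomputable section

open MeasureTheory Set
open Literature.NumberTheory.Transcendental

namespace Summit.KontsevichZagierPeriods.SymplecticScissors.LogPolytope

/-! ## The Λ-box replacing one binomial cell -/

/-- **One binomial cell, one Λ-box.** For the binomial cell with data `(M, sa, sc)`,
`sc = (∏ sa) · α^{su} β^{sv}`, `α^{su} β^{sv} > 1`, there is an integrand-`1` representation on the
corner-`1` log-box with edge ratios `α^{U ι} β^{V ι}` (`U = (su, …)[0 ↦ su / N]`,
`V = (sv, …)[0 ↦ sv / N]`, `N = |det M| (n + 1)!`), all ratios `> 1`, whose class equals the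
class of the cell (`stub_binomialCellToBox` with `stub_matrixPowerMove`, `bsc_box_eq`). [folklore] -/
theorem bcert_box {n : ℕ} {α β : ℝ} (hα : 0 < α) (hβ : 0 < β) (hαa : IsAlgebraic ℚ α)
    (hβa : IsAlgebraic ℚ β) {M : Matrix (Fin (n + 1)) (Fin (n + 1)) ℤ} {sa : Fin (n + 1) → ℝ}
    {sc : ℝ} {su sv : ℚ} {ρ : KZ.IntegralRep (n + 1 + 1)} (hM : M.det ≠ 0) (hsa : ∀ ι, 0 < sa ι)
    (hsaa : ∀ ι, IsAlgebraic ℚ (sa ι)) (hsca : IsAlgebraic ℚ sc)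
    (hsc : sc = (∏ ι, sa ι) * (α ^ ((su : ℚ) : ℝ) * β ^ ((sv : ℚ) : ℝ)))
    (hlt : 1 < α ^ ((su : ℚ) : ℝ) * β ^ ((sv : ℚ) : ℝ))
    (hρd : ρ.domain = {p : Fin (n + 1 + 1) → ℝ | (∀ ι : Fin (n + 1), 0 < p (Fin.castSucc ι)) ∧
        (∀ k : Fin (n + 1), sa k < ∏ j : Fin (n + 1), p (Fin.castSucc j) ^ (M k j)) ∧
        ∏ k : Fin (n + 1), ∏ j : Fin (n + 1), p (Fin.castSucc j) ^ (M k j) < sc ∧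
        0 < p (Fin.last (n + 1)) ∧ p (Fin.last (n + 1)) * ∏ ι : Fin (n + 1), p (Fin.castSucc ι) < 1})
    (hρi : ∀ p ∈ ρ.domain, ρ.integrand p = 1) :
    ∃ σ : KZ.IntegralRep (n + 1 + 1), (∀ ξ ∈ σ.domain, σ.integrand ξ = 1) ∧
      (∀ ι : Fin (n + 1), 1 < α ^ ((Function.update (fun _ : Fin (n + 1) => su) 0
          (su / ((M.det.natAbs * (n + 1).factorial : ℕ) : ℚ)) ι : ℚ) : ℝ) *
        β ^ ((Function.update (fun _ : Fin (n + 1) => sv) 0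
          (sv / ((M.det.natAbs * (n + 1).factorial : ℕ) : ℚ)) ι : ℚ) : ℝ)) ∧
      σ.domain = {ξ : Fin (n + 1 + 1) → ℝ | (∀ ι : Fin (n + 1), (1 : ℝ) < ξ (Fin.castSucc ι) ∧
        ξ (Fin.castSucc ι) < 1 * (α ^ ((Function.update (fun _ : Fin (n + 1) => su) 0
            (su / ((M.det.natAbs * (n + 1).factorial : ℕ) : ℚ)) ι : ℚ) : ℝ) *
          β ^ ((Function.update (fun _ : Fin (n + 1) => sv) 0
            (sv / ((M.det.natAbs * (n + 1).factorial : ℕ) : ℚ)) ι : ℚ) : ℝ))) ∧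
        0 < ξ (Fin.last (n + 1)) ∧ ξ (Fin.last (n + 1)) * ∏ ι : Fin (n + 1), ξ (Fin.castSucc ι) < 1} ∧
      KZ.of ρ - KZ.of σ ∈ KZ.relations := by
  -- adapted from `bsc_side` (…BinomialSector.lean), the case of a single cell
  have hcor : ∀ uu vv : ℚ, IsAlgebraic ℚ (α ^ ((uu : ℚ) : ℝ) * β ^ ((vv : ℚ) : ℝ)) :=
    fun uu vv => (mxs_rpow_isAlgebraic hα hαa uu).mul (mxs_rpow_isAlgebraic hβ hβa vv)
  have h1a : IsAlgebraic ℚ (1 : ℝ) := isAlgebraic_one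
  have hN : (0 : ℝ) < ((M.det.natAbs * (n + 1).factorial : ℕ) : ℝ) :=
    Nat.cast_pos.mpr (Nat.mul_pos (Int.natAbs_pos.mpr hM) (Nat.factorial_pos _))
  -- the ratios exceed `1`
  have hSlt : ∀ ι : Fin (n + 1),
      1 < α ^ ((Function.update (fun _ : Fin (n + 1) => su) 0
          (su / ((M.det.natAbs * (n + 1).factorial : ℕ) : ℚ)) ι : ℚ) : ℝ) *
        β ^ ((Function.update (fun _ : Fin (n + 1) => sv) 0
          (sv / ((M.det.natAbs * (n + 1).factorial : ℕ) : ℚ)) ι : ℚ) : ℝ) := by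
    intro ι
    rcases eq_or_ne ι 0 with rfl | hι
    · simp only [Function.update_self]
      rw [mxs_root_eq hα.le hβ.le]
      exact Real.one_lt_rpow hlt (inv_pos.mpr hN)
    · simp only [Function.update_of_ne hι]
      exact hlt
  -- the box representation
  obtain ⟨σ, hσd, hσi⟩ := stub_logBoxCut.1 (n + 1) (fun _ => 1) (fun ι => 1 *
      (α ^ ((Function.update (fun _ : Fin (n + 1) => su) 0
          (su / ((M.det.natAbs * (n + 1).factorial : ℕ) : ℚ)) ι : ℚ) : ℝ) *
        β ^ ((Function.update (fun _ : Fin (n + 1) => sv) 0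
          (sv / ((M.det.natAbs * (n + 1).factorial : ℕ) : ℚ)) ι : ℚ) : ℝ)))
    (fun _ => one_pos) (fun _ => h1a) (fun _ => h1a.mul (hcor _ _))
  have hσi' : ∀ ξ ∈ σ.domain, σ.integrand ξ = 1 := fun ξ _ => by rw [hσi]
  -- `binomial cell ~ box`
  have hP : (0 : ℝ) < ∏ ι, sa ι := Finset.prod_pos fun ι _ => hsa ι
  have hrel : KZ.of ρ - KZ.of σ ∈ KZ.relations := by
    refine stub_binomialCellToBox stub_matrixPowerMove n M sa sc hM hsa hsaa hsca ?_ ρ σ hρd ?_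
      hρi hσi'
    · rw [hsc]
      exact lt_mul_of_one_lt_right hP hlt
    · rw [hσd]
      exact bsc_box_eq hα.le hβ.le hsa hsc
  exact ⟨σ, hσi', hSlt, hσd, hrel⟩

/-! ## The stub -/

/-- **Stub v6-7 (BINOMIAL CERTIFICATE).** Every integrand-`1` representation on a binomial cell
`{x > 0, sa_k < x^{M_k}, ∏_k x^{M_k} < sc}` (`M ∈ ℤ^{(n+1)×(n+1)}`, `det M ≠ 0`, Λ-datum
`sc = ∏ sa · α^{su} β^{sv}` with `α^{su} β^{sv} > 1`) carries a torsion certificate over Λ-boxes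
with `d = 1`: `[cell] − [box] ∈ relations` for the corner-`1` log-box of edge ratios
`(g^{1/(|det M|(n+1)!)}, g, …, g)`, `g = α^{su} β^{sv}` (landed `stub_binomialCellToBox` fed with
`stub_matrixPowerMove`; box representations exist by `stub_logBoxCut`; the box is a Λ-box with
rational exponents `su/(|det M|(n+1)!)`, …). [folklore] -/
theorem stub_binomialCertificate : ∀ (n : ℕ) (α β : ℝ), 0 < α → 0 < β → IsAlgebraic ℚ α → IsAlgebraic ℚ β →
    ∀ (M : Matrix (Fin (n + 1)) (Fin (n + 1)) ℤ) (sa : Fin (n + 1) → ℝ) (sc : ℝ) (su sv : ℚ)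
      (ρ : KZ.IntegralRep (n + 1 + 1)),
    M.det ≠ 0 → (∀ ι, 0 < sa ι) → (∀ ι, IsAlgebraic ℚ (sa ι)) → IsAlgebraic ℚ sc →
    sc = (∏ ι, sa ι) * (α ^ ((su : ℚ) : ℝ) * β ^ ((sv : ℚ) : ℝ)) →
    1 < α ^ ((su : ℚ) : ℝ) * β ^ ((sv : ℚ) : ℝ) →
    ρ.domain = {p : Fin (n + 1 + 1) → ℝ | (∀ ι : Fin (n + 1), 0 < p (Fin.castSucc ι)) ∧
        (∀ k : Fin (n + 1), sa k < ∏ j : Fin (n + 1), p (Fin.castSucc j) ^ (M k j)) ∧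
        ∏ k : Fin (n + 1), ∏ j : Fin (n + 1), p (Fin.castSucc j) ^ (M k j) < sc ∧
        0 < p (Fin.last (n + 1)) ∧ p (Fin.last (n + 1)) * ∏ ι : Fin (n + 1), p (Fin.castSucc ι) < 1} →
    (∀ p ∈ ρ.domain, ρ.integrand p = 1) →
    ∃ (d l : ℕ) (σ : Fin l → KZ.IntegralRep (n + 1 + 1)) (w : Fin l → ℤ), d ≠ 0 ∧
        (∀ j, w j ≠ 0 → ∃ (a : Fin (n + 1) → ℝ) (u v : Fin (n + 1) → ℚ),
          (∀ ξ ∈ (σ j).domain, (σ j).integrand ξ = 1) ∧ (∀ ι, 0 < a ι) ∧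
          (∀ ι, IsAlgebraic ℚ (a ι)) ∧ (∀ ι, 1 < α ^ ((u ι : ℚ) : ℝ) * β ^ ((v ι : ℚ) : ℝ)) ∧
          (σ j).domain = {ξ : Fin (n + 1 + 1) → ℝ | (∀ ι : Fin (n + 1), a ι < ξ (Fin.castSucc ι) ∧
            ξ (Fin.castSucc ι) < a ι * (α ^ ((u ι : ℚ) : ℝ) * β ^ ((v ι : ℚ) : ℝ))) ∧
            0 < ξ (Fin.last (n + 1)) ∧ ξ (Fin.last (n + 1)) * ∏ ι : Fin (n + 1), ξ (Fin.castSucc ι) < 1}) ∧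
        d • KZ.of ρ - ∑ j, w j • KZ.of (σ j) ∈ KZ.relations := by
  intro n α β hα hβ hαa hβa M sa sc su sv ρ hM hsa hsaa hsca hsc hlt hρd hρi
  obtain ⟨σ, hσi, hSlt, hσd, hrel⟩ := bcert_box hα hβ hαa hβa hM hsa hsaa hsca hsc hlt hρd hρi
  refine ⟨1, 1, fun _ => σ, fun _ => 1, one_ne_zero, fun _ _ => ⟨fun _ => 1, _, _, hσi,
    fun _ => one_pos, fun _ => isAlgebraic_one, hSlt, hσd⟩, ?_⟩
  simpa only [one_smul, Fin.sum_univ_one] using hrel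

end Summit.KontsevichZagierPeriods.SymplecticScissors.LogPolytope

end
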